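import Summits.AnomalousDissipation.AnomalousDissipation.Theorems.GenericRunawayStokesScaling.Negative.Deriv
import Literature.Analysis.Calculus.RegularZeroSetOneDimProofs

/-!
# Route MirrorVariety — support item `MirrorDisconnection` (stmt-AnomalousDissipation-2989)

For every finite resolution (`S = (freqBall N).erase 0`) and every nonzero real solenoidal force vector
`g ∈ galerkinSubspace S` which is a REGULAR value of `F(c, ν) = galerkinRHS S ν g c` on
`galerkinSubspace S × ℝ`, every point `z` of the steady Galerkin variety
`V = {(c, ν) : c ∈ galerkinSubspace S, F(c, ν) = 0}` has a compact connected component, or a connected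
component not containing the mirror point `-z = σ z`.

## Proof (as filed on the item, all inputs proved in the tree)

* `F(-c, -ν) = F(c, ν)` (`Negative.galerkinRHS_neg_neg`), so `σ = -id` preserves `V`; and `σ` is free on
  `V` because `F(0, 0) = Π ĝ = ĝ ≠ 0` (`Fmap_zero`).
* Restrict `F` to the phase space: `f : galerkinSubspace S × ℝ → galerkinSubspace S`,
  `f = P ∘ F ∘ ι` with `ι` the inclusion and `P` a linear projection onto `galerkinSubspace S`
  (`F ∘ ι` already lands in the subspace, `galerkinRHS_mem`). `F` is a polynomial map, hence smooth
  (`contDiff_Fmap`, from `Negative.hasFDerivAt_Fmap` and linearity of `z ↦ DF(z)`); the item's regularity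
  hypothesis says exactly that `Df_x` is onto at every zero; `dim (G × ℝ) = dim G + 1`.
* The PROVED Literature theorem `milnor_regularZeroSet_component_circle_or_line_holds`
  [MilnorTDV1965, §2 Lemma 1 + Appendix] gives: each component of `f⁻¹(0)` is homeomorphic to the circle
  (then compact, and so is its image, the component of `V`) or to `ℝ`.
* In the second case, if `-z` were in the component `K` of `z`, then `σ` would restrict to a continuous
  fixed-point-free involution of `K ≃ₜ ℝ`; but every continuous involution `φ` of `ℝ` has a fixed point
  (`ψ = φ - id` satisfies `ψ ∘ φ = -ψ`, intermediate value theorem) — `exists_fixedPoint_of_involutive_real`.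

Components are transported along the (local) embedding `ι` by `image_connectedComponentIn_of_isEmbedding`.
No new definitions are introduced (the inclusion and the projection are local to the proof).

Sources: J. Milnor, *Topology from the Differentiable Viewpoint* (1965), §2 Lemma 1, Appendix (vendored and
proved in `Literature/Analysis/Calculus/RegularZeroSetOneDim*.lean`); the rest is folklore.  The Galerkin
calculus (`Fmap`, `derivCLM`, `hasFDerivAt_Fmap`, the mirror identity) is imported from the landed
negative-knowledge files `Theorems/GenericRunawayStokesScaling/Negative/{Frame,Deriv}.lean`.
-/

-- `Summit.<Summit>.<Problem>` is the tree's mandated summit-side namespace (CONVENTIONS §2); for this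
-- single-conjunct summit the two coincide, so the duplicate is deliberate.
set_option linter.dupNamespace false

noncomputable section

open scoped BigOperators InnerProductSpace ComplexConjugate Topology ContDiff
open Filter Set Function

namespace Summit.AnomalousDissipation.AnomalousDissipation.Theorems.MirrorDisconnection

open Literature.Analysis.FunctionSpaces Literature.Analysis.FunctionSpaces.Torus
open Literature.Analysis.FluidPDE Literature.Analysis.FluidPDE.Torus
open Literature.Analysis.Calculus
open Summit.AnomalousDissipation.AnomalousDissipation.Theses.MirrorVariety
open Summit.AnomalousDissipation.AnomalousDissipation.Theorems.GenericRunawayStokesScaling.Negative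

/-! ## §1 Topology: continuous involutions of the line have fixed points -/

/-- **Every continuous involution of `ℝ` has a fixed point**: with `ψ x = φ x - x` one has
`ψ (φ x) = -ψ x`, so `ψ` takes both signs and vanishes somewhere (intermediate value theorem). [folklore] -/
theorem exists_fixedPoint_of_involutive_real {φ : ℝ → ℝ} (hφ : Continuous φ)
    (hinv : Function.Involutive φ) : ∃ x, φ x = x := by
  set ψ : ℝ → ℝ := fun x => φ x - x with hψ
  have hψc : Continuous ψ := hφ.sub continuous_id
  have hanti : ∀ x, ψ (φ x) = -ψ x := fun x => by
    simp only [hψ, hinv x]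
    ring
  have h0 : (0 : ℝ) ∈ range ψ := by
    rcases le_total (ψ 0) 0 with h | h
    · exact mem_range_of_exists_le_of_exists_ge hψc ⟨0, h⟩ ⟨φ 0, by rw [hanti]; linarith⟩
    · exact mem_range_of_exists_le_of_exists_ge hψc ⟨φ 0, by rw [hanti]; linarith⟩ ⟨0, h⟩
  obtain ⟨x, hx⟩ := h0
  exact ⟨x, sub_eq_zero.1 hx⟩

/-- A continuous involution of a space homeomorphic to `ℝ` has a fixed point. [folklore] -/
theorem exists_fixedPoint_of_involutive_of_homeomorph_real {X : Type*} [TopologicalSpace X]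
    (e : X ≃ₜ ℝ) {σ : X → X} (hσ : Continuous σ) (hinv : Function.Involutive σ) :
    ∃ x, σ x = x := by
  obtain ⟨y, hy⟩ := exists_fixedPoint_of_involutive_real (φ := e ∘ σ ∘ e.symm)
    (e.continuous.comp (hσ.comp e.symm.continuous)) (fun y => by
      simp only [Function.comp_apply, Homeomorph.symm_apply_apply, hinv (e.symm y),
        Homeomorph.apply_symm_apply])
  refine ⟨e.symm y, e.injective ?_⟩
  rw [Homeomorph.apply_symm_apply]
  exact hy

/-- **Components along an embedding**: for a topological embedding `ι` and any set `Z`, the connected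
component of `ι x` in `ι '' Z` is the image of the connected component of `x` in `Z`. [folklore] -/
theorem image_connectedComponentIn_of_isEmbedding {A B : Type*} [TopologicalSpace A]
    [TopologicalSpace B] {ι : A → B} (hι : Topology.IsEmbedding ι) (Z : Set A) (x : A) :
    ι '' connectedComponentIn Z x = connectedComponentIn (ι '' Z) (ι x) := by
  by_cases hx : x ∈ Z
  swap
  · rw [connectedComponentIn_eq_empty hx, image_empty, connectedComponentIn_eq_empty]
    rintro ⟨y, hy, hyx⟩
    exact hx (hι.injective hyx ▸ hy)
  apply Subset.antisymm
  · exact (isPreconnected_connectedComponentIn.image ι hι.continuous.continuousOn)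
      |>.subset_connectedComponentIn (mem_image_of_mem ι (mem_connectedComponentIn hx))
        (image_mono (connectedComponentIn_subset Z x))
  · set K := connectedComponentIn (ι '' Z) (ι x) with hK
    have hKZ : K ⊆ ι '' Z := connectedComponentIn_subset _ _
    have hKeq : ι '' (ι ⁻¹' K) = K :=
      image_preimage_eq_of_subset (hKZ.trans (image_subset_range _ _))
    have hpre : IsPreconnected (ι ⁻¹' K) := by
      rw [← hι.isInducing.isPreconnected_image, hKeq]
      exact isPreconnected_connectedComponentIn
    have hxK : x ∈ ι ⁻¹' K := mem_connectedComponentIn (mem_image_of_mem ι hx)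
    have hsub : ι ⁻¹' K ⊆ Z := fun y hy => by
      obtain ⟨y', hy', hyy⟩ := hKZ hy
      exact hι.injective hyy ▸ hy'
    rw [← hKeq]
    exact image_mono (hpre.subset_connectedComponentIn hxK hsub)

/-! ## §2 The Galerkin map is smooth; its restriction to the phase space -/

section Galerkin

variable {S : Finset (Fin 3 → ℤ)}

/-- `L_c` is additive in `c`. [folklore] -/
theorem symB_add_left (c c' v : ↥S → EuclideanSpace ℂ (Fin 3)) :
    symB S (c + c') v = symB S c v + symB S c' v := by
  simp only [symB, projB_add_left, projB_add_right]
  abel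

/-- `L_c` is real-homogeneous in `c`. [folklore] -/
theorem symB_smul_left (a : ℝ) (c v : ↥S → EuclideanSpace ℂ (Fin 3)) :
    symB S (a • c) v = a • symB S c v := by
  simp only [symB, projB_smul_left, projB_smul_right, smul_add]

/-- `DF(z)` is additive in the base point `z` (`F` is a polynomial of degree two). [folklore] -/
theorem derivCLM_add (z z' : (↥S → EuclideanSpace ℂ (Fin 3)) × ℝ) :
    derivCLM S (z + z') = derivCLM S z + derivCLM S z' := by
  refine ContinuousLinearMap.ext fun h => ?_
  simp only [derivCLM_apply, _root_.add_apply, derivFun, Prod.fst_add, Prod.snd_add, stokesA_add,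
    add_smul, smul_add, symB_add_left]
  abel

/-- `DF(z)` is real-homogeneous in the base point `z`. [folklore] -/
theorem derivCLM_smul (a : ℝ) (z : (↥S → EuclideanSpace ℂ (Fin 3)) × ℝ) :
    derivCLM S (a • z) = a • derivCLM S z := by
  refine ContinuousLinearMap.ext fun h => ?_
  simp only [derivCLM_apply, _root_.smul_apply, derivFun, Prod.smul_fst, Prod.smul_snd,
    smul_eq_mul, stokesA_smul, symB_smul_left, mul_smul, smul_sub, smul_neg, smul_comm h.2 a]

/-- **The Galerkin map `F(c, ν) = galerkinRHS S ν g c` is smooth** (a polynomial map: it is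
differentiable with derivative `DF(z)` depending linearly, hence smoothly, on `z`). [folklore] -/
theorem contDiff_Fmap (g : ↥S → EuclideanSpace ℂ (Fin 3)) : ContDiff ℝ ∞ (Fmap S g) := by
  rw [contDiff_infty_iff_fderiv]
  refine ⟨fun z => (hasFDerivAt_Fmap g z).differentiableAt, ?_⟩
  -- `z ↦ DF(z)` as a linear, hence continuous linear, map
  let L : ((↥S → EuclideanSpace ℂ (Fin 3)) × ℝ) →ₗ[ℝ]
      (((↥S → EuclideanSpace ℂ (Fin 3)) × ℝ) →L[ℝ] (↥S → EuclideanSpace ℂ (Fin 3))) :=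
    { toFun := fun z => derivCLM S z
      map_add' := derivCLM_add
      map_smul' := derivCLM_smul }
  have h : fderiv ℝ (Fmap S g) = ⇑(LinearMap.toContinuousLinearMap L) := by
    funext z
    rw [(hasFDerivAt_Fmap g z).fderiv, LinearMap.coe_toContinuousLinearMap']
    rfl
  rw [h]
  exact (LinearMap.toContinuousLinearMap L).contDiff

/-- `F(0, 0) = Π ĝ = ĝ` for a solenoidal force: the origin is NOT on the variety of a nonzero force
(this is what makes the mirror `σ` free on `V`). [folklore] -/
theorem Fmap_zero {g : ↥S → EuclideanSpace ℂ (Fin 3)} (hg : g ∈ galerkinSubspace S) :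
    Fmap S g 0 = g := by
  rw [Fmap_apply]
  funext k
  simp only [Prod.snd_zero, Prod.fst_zero, zero_smul, neg_zero, zero_add, projB_zero_left, sub_zero,
    leraySym_apply_of_mem hg]

/-- The mirror identity for `Fmap`: `F(-z) = F(z)`. [folklore] -/
theorem Fmap_neg (g : ↥S → EuclideanSpace ℂ (Fin 3)) (z : (↥S → EuclideanSpace ℂ (Fin 3)) × ℝ) :
    Fmap S g (-z) = Fmap S g z := by
  simp only [Fmap, Prod.fst_neg, Prod.snd_neg, galerkinRHS_neg_neg]

end Galerkin

/-! ## §3 The theorem -/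

/-- **Mirror disconnection on the steady Galerkin variety** (general finite symmetric frequency set):
for `S` symmetric, `g ∈ galerkinSubspace S` nonzero and a regular value in the sense of the item, every
point `z` of `V_S(g)` has a compact connected component or a component missing `-z`.  Milnor's
classification of the components (circle or line, proved in the tree) plus the fixed point of a
continuous involution of the line. [folklore] -/
theorem isCompact_or_neg_notMem_connectedComponentIn {S : Finset (Fin 3 → ℤ)}
    (hS : ∀ k ∈ S, -k ∈ S) {g : ↥S → EuclideanSpace ℂ (Fin 3)} (hg : g ∈ galerkinSubspace S)
    (hg0 : g ≠ 0) (hreg : Regular S g) {z : (↥S → EuclideanSpace ℂ (Fin 3)) × ℝ}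
    (hz : z ∈ variety S g) :
    IsCompact (connectedComponentIn (variety S g) z) ∨ -z ∉ connectedComponentIn (variety S g) z := by
  classical
  set G : Submodule ℝ (↥S → EuclideanSpace ℂ (Fin 3)) := galerkinSubspace S with hGdef
  -- a linear projection onto the phase space
  obtain ⟨Q, hGQ⟩ := G.exists_isCompl
  set P : (↥S → EuclideanSpace ℂ (Fin 3)) →L[ℝ] ↥G :=
    LinearMap.toContinuousLinearMap (G.projectionOnto Q hGQ) with hPdef
  have hP : ∀ (v : ↥S → EuclideanSpace ℂ (Fin 3)) (hv : v ∈ G), P v = ⟨v, hv⟩ := fun v hv => by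
    rw [hPdef, LinearMap.coe_toContinuousLinearMap']
    exact Submodule.projectionOnto_apply_of_mem_left hGQ hv
  -- the inclusion `ι : G × ℝ → (S → ℂ³) × ℝ`, a linear topological embedding
  set ι : (↥G × ℝ) →L[ℝ] ((↥S → EuclideanSpace ℂ (Fin 3)) × ℝ) :=
    (G.subtypeL).prodMap (ContinuousLinearMap.id ℝ ℝ) with hιdef
  have hιemb : Topology.IsEmbedding ι := by
    have h : ⇑ι = Prod.map (Subtype.val : ↥G → _) (id : ℝ → ℝ) := funext fun y => rfl
    rw [h]
    exact Topology.IsEmbedding.subtypeVal.prodMap Topology.IsEmbedding.id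
  -- the restricted map `f = P ∘ F ∘ ι : G × ℝ → G`
  set f : ↥G × ℝ → ↥G := fun x => P (Fmap S g (ι x)) with hfdef
  have hFmem : ∀ x : ↥G × ℝ, Fmap S g (ι x) ∈ G := fun x =>
    galerkinRHS_mem x.2 hS hg.1 x.1.2
  have hzero : ∀ x : ↥G × ℝ, f x = 0 ↔ Fmap S g (ι x) = 0 := fun x => by
    rw [hfdef]
    dsimp only
    rw [hP _ (hFmem x), Submodule.mk_eq_zero]
  have hZ : univ ∩ f ⁻¹' {0} = {x | Fmap S g (ι x) = 0} := by
    ext x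
    rw [univ_inter, mem_preimage, mem_singleton_iff, Set.mem_setOf_eq]
    exact hzero x
  have hV : variety S g = ι '' (univ ∩ f ⁻¹' {0}) := by
    rw [hZ]
    ext w
    constructor
    · rintro ⟨hw1, hw2⟩
      exact ⟨(⟨w.1, hw1⟩, w.2), hw2, rfl⟩
    · rintro ⟨y, hy, rfl⟩
      exact ⟨y.1.2, hy⟩
  -- smoothness and regularity of `f`
  have hf : ContDiff ℝ ∞ f := P.contDiff.comp ((contDiff_Fmap g).comp ι.contDiff)
  have hderiv : ∀ x : ↥G × ℝ,
      HasFDerivAt f (P.comp ((derivCLM S (ι x)).comp ι)) x := fun x =>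
    P.hasFDerivAt.comp x ((hasFDerivAt_Fmap g (ι x)).comp x ι.hasFDerivAt)
  have hreg' : ∀ x ∈ (univ : Set (↥G × ℝ)), f x = 0 → (fderiv ℝ f x).range = ⊤ := by
    intro x _ hx0
    rw [(hderiv x).fderiv]
    refine LinearMap.range_eq_top.2 fun w => ?_
    have hxV : ι x ∈ variety S g := by
      rw [hV]
      exact mem_image_of_mem _ ⟨mem_univ _, hx0⟩
    obtain ⟨v, hv, t, hvt⟩ := hreg (ι x) hxV w w.2
    rw [fderiv_galerkinRHS_apply] at hvt
    refine ⟨(⟨v, hv⟩, t), ?_⟩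
    show P (derivCLM S (ι x) (ι (⟨v, hv⟩, t))) = w
    rw [derivCLM_apply, show ι (⟨v, hv⟩, t) = (v, t) from rfl, hvt, hP _ w.2]
  have hdim : Module.finrank ℝ (↥G × ℝ) = Module.finrank ℝ ↥G + 1 := by
    rw [Module.finrank_prod, Module.finrank_self]
  -- the point `z` upstairs
  set x : ↥G × ℝ := (⟨z.1, hz.1⟩, z.2) with hxdef
  have hxz : ι x = z := rfl
  have hx0 : f x = 0 := (hzero x).2 (by rw [hxz]; exact hz.2)
  -- Milnor: the component upstairs is a circle or a line
  have hM := milnor_regularZeroSet_component_circle_or_line_holds (↥G × ℝ) ↥G hdim f univ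
    isOpen_univ hf.contDiffOn hreg' x (mem_univ _) hx0
  set KE := connectedComponentIn (univ ∩ f ⁻¹' {0}) x with hKEdef
  have hK : ι '' KE = connectedComponentIn (variety S g) z := by
    rw [hKEdef, image_connectedComponentIn_of_isEmbedding hιemb, ← hV, hxz]
  rcases hM with hM | hM
  · -- circle: compact component
    obtain ⟨e⟩ := hM
    left
    have : CompactSpace ↥KE := e.symm.compactSpace
    rw [← hK]
    exact (isCompact_iff_compactSpace.2 this).image ι.continuous
  · -- line: the mirror cannot preserve the component
    obtain ⟨e⟩ := hM
    right
    intro hneg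
    -- `-x` lies in the component upstairs
    have hnegx : -x ∈ KE := by
      rw [← hK] at hneg
      obtain ⟨y, hy, hyx⟩ := hneg
      have : y = -x := hιemb.injective (by rw [hyx, map_neg, hxz])
      exact this ▸ hy
    -- the zero set upstairs is mirror invariant
    have hZneg : ∀ y ∈ univ ∩ f ⁻¹' {0}, -y ∈ univ ∩ f ⁻¹' {0} := by
      intro y hy
      rw [hZ] at hy ⊢
      rw [Set.mem_setOf_eq] at hy ⊢
      rw [map_neg, Fmap_neg]
      exact hy
    -- so the mirror maps the component of `x` into the component of `-x`, which is the same
    have hσ : ∀ y ∈ KE, -y ∈ KE := by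
      intro y hy
      have himg : (fun w => -w) '' KE ⊆ connectedComponentIn (univ ∩ f ⁻¹' {0}) (-x) :=
        (isPreconnected_connectedComponentIn.image _ continuous_neg.continuousOn)
          |>.subset_connectedComponentIn (mem_image_of_mem _ (mem_connectedComponentIn
              ⟨mem_univ _, hx0⟩))
            (by
              rintro _ ⟨w, hw, rfl⟩
              exact hZneg w (connectedComponentIn_subset _ _ hw))
      rw [← connectedComponentIn_eq hnegx] at himg
      exact himg (mem_image_of_mem _ hy)
    -- a continuous fixed-point-free involution of `KE ≃ₜ ℝ`: impossible
    set σ' : ↥KE → ↥KE := fun y => ⟨-y.1, hσ y.1 y.2⟩ with hσ'def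
    have hσ'c : Continuous σ' := (continuous_neg.comp continuous_subtype_val).subtype_mk _
    have hσ'i : Function.Involutive σ' := fun y => Subtype.ext (neg_neg _)
    obtain ⟨y, hy⟩ := exists_fixedPoint_of_involutive_of_homeomorph_real e hσ'c hσ'i
    have hy0 : (y : ↥G × ℝ) = 0 := by
      have h1 : -(y : ↥G × ℝ) = y := congrArg Subtype.val hy
      have h2 : (2 : ℝ) • (y : ↥G × ℝ) = 0 := by
        rw [two_smul]
        nth_rewrite 1 [← h1]
        exact neg_add_cancel _
      exact (smul_eq_zero.1 h2).resolve_left two_ne_zero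
    have hmem : (y : ↥G × ℝ) ∈ univ ∩ f ⁻¹' {0} := connectedComponentIn_subset _ _ y.2
    rw [hy0, hZ, mem_setOf_eq, map_zero, Fmap_zero hg] at hmem
    exact hg0 hmem

end Summit.AnomalousDissipation.AnomalousDissipation.Theorems.MirrorDisconnection

namespace Summit.AnomalousDissipation.AnomalousDissipation.Theorems

open Summit.AnomalousDissipation.AnomalousDissipation.Theorems.GenericRunawayStokesScaling.Negative
open Summit.AnomalousDissipation.AnomalousDissipation.Theorems.MirrorDisconnection

/-- **`MirrorVariety.MirrorDisconnection` holds** (item stmt-AnomalousDissipation-2989): at every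
resolution `N`, for every nonzero real solenoidal force `g ∈ galerkinSubspace S`, `S = (freqBall N).erase 0`,
which is a regular value of `(c, ν) ↦ galerkinRHS S ν g c` on `galerkinSubspace S × ℝ`, every point `z` of the
steady Galerkin variety has a compact connected component or a component not containing `-z`.
Milnor 1965 (§2 Lemma 1, Appendix; proved in the tree) + the fixed point of a continuous involution of `ℝ`.
[folklore] -/
theorem mirrorDisconnection_proof :
    Summit.AnomalousDissipation.AnomalousDissipation.Theses.MirrorVariety.MirrorDisconnection := by
  unfold Summit.AnomalousDissipation.AnomalousDissipation.Theses.MirrorVariety.MirrorDisconnection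
  intro N S hS g hg hg0 V hV hreg z hz
  subst hV
  have hSsym : ∀ k ∈ S, -k ∈ S := by
    subst hS
    exact PB_symm N
  exact isCompact_or_neg_notMem_connectedComponentIn hSsym hg hg0 hreg hz

end Summit.AnomalousDissipation.AnomalousDissipation.Theorems
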